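import Summits.MatrixMultiplication.MatrixMultiplication.Theorems.AbelianSTPPCensusVQWitness483

/-!
# The vQ-alive T_E list at order 472 in the kernel: `(6,6,8)⁴ + (3,4,4)`
(cell mm-stpp, vp-p2 g2; found by vp-p2 g1's budgeted checker; REF [255]; planner g13 scratch no. 9)

Companion of `AbelianSTPPCensusVQWitnesses.lean` / `AbelianSTPPCensusVQWitness483.lean` (separate file for the 400-line rule).
vp-p2 g1's budgeted vQ certificate `ShapeCertVQ.checkQE` (leaves `noAbelianSTPPHostUpTo_250_359/402/417`) is EXCLUDED at every
order `≤ 471` (seat sizing, kernel so far to `417`) and first fails at `472` on the mixed list `(6,6,8)⁴ + (3,4,4)`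
(size vectors `![6,6,6,6,3]`, `![6,6,6,6,4]`, `![8,8,8,8,4]`, written inline — this file declares no definitions;
volumes `288, 288, 288, 288, 48`).  REF [255] re-checked it under the EXACT rules and the planner's scratch no. 9
(`HOME/mm-stpp-plan/calc/g13/VQWitness472_scratch.lean`, rc 0) typed it; this file LANDS it, line by line in the pattern of the 483 file:

* `w472_admissible` — vP-admissible at the composite order `472 = 8·59` (vM by evaluation; U11-G in all three letter forms; U11-P not invoked);
* `w472_e3pAdm` — E3⁺-admissible under the kernel predicate `STPPThreeRoomEnergy.E3pAdm`: each fat member `(6,6,8)` has off-member sums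
  `S_A = 160`, `S_B = 156`, `S_C = 120` and `e3pLHS = 82 564 ≤ 288² = 82 944` — slack exactly `380` (`w472_e3p_slack`); the `(3,4,4)`
  member is silent (`2·48 ≤ 472`);
* `w472_beats` — the list beats `5/2`: `4·288^{5/6} + 48^{5/6} ≥ 4·112 + 25.17 = 473.17 > 472` from the certified sixth-power bounds
  `112⁶ ≤ 288⁵` and `25.17⁶ ≤ 48⁵` (exact value `473.463…`, REF [255]).

So `vqCensusTE_fails_at_472` (per-order ∃ form), `vqpCensusTE_false_above_472` (E3⁺ form = the scratch statement) and
`vqCensusTE_false_above_472` (E3 shape form).  With `vqpCensusTE_false_above_483` (p527788) superseded as the explicit upper end, the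
T_E bracket under vQ := vP ∧ E3⁺ reads: first vQ-alive order `≤ 472` (kernel, this file); the budgeted certificate's verdict EXCLUDED
through `471` is seat sizing (kernel through `417`, `noAbelianSTPPHostUpTo_250_417`), so «first vQ-alive = 472 exactly» becomes a theorem
only when `checkQE_418 … checkQE_471` land.  Side remark (REF [255]): eng-1's oracle scans at 490 / 483 used sides `≥ 5` / `6…8` and could
not see this list (side `3`).
WHAT THIS IS NOT: no STPP family with these shapes is claimed to exist («alive» = the instrument cannot exclude it); no census number;
no `ω` statement; nothing about non-abelian hosts.
-/

-- single-conjunct summit: the mandated namespace repeats `MatrixMultiplication`.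
set_option linter.dupNamespace false
set_option autoImplicit false

namespace Summit.MatrixMultiplication.MatrixMultiplication.Theorems

namespace AbelianSTPPCensusVP

open Finset STPPThreeRoomEnergy

/-! The 472 witness `(6,6,8)⁴ + (3,4,4)` is written inline as the three size vectors
`![6, 6, 6, 6, 3]` (first sizes), `![6, 6, 6, 6, 4]` (middle sizes), `![8, 8, 8, 8, 4]` (last sizes) — no new definitions. -/

/-- The 472 witness beats `5/2` (certified sixth-power bounds `112 ≤ 288^{5/6}`, `25.17 ≤ 48^{5/6}`; `4·112 + 25.17 = 473.17 > 472`).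
[original] -/
theorem w472_beats : Beats (5 / 2) 472 (![6, 6, 6, 6, 3] : Fin 5 → ℕ) ![6, 6, 6, 6, 4] ![8, 8, 8, 8, 4] := by
  unfold Beats
  have h1 : (112 : ℝ) ≤ (288 : ℝ) ^ ((5 : ℝ) / 6) := le_rpow_five_sixths (by norm_num) (by norm_num) (by norm_num)
  have h2 : (25.17 : ℝ) ≤ (48 : ℝ) ^ ((5 : ℝ) / 6) := le_rpow_five_sixths (by norm_num) (by norm_num) (by norm_num)
  have hexp : ((5 : ℝ) / 2 / 3) = (5 : ℝ) / 6 := by norm_num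
  simp only [Fin.sum_univ_five, shapeVol, hexp]
  simp only [Matrix.cons_val_zero, Matrix.cons_val_one, Matrix.cons_val]
  norm_num
  linarith

set_option maxRecDepth 20000 in
/-- The 472 witness is vP-admissible at the composite order `472 = 8·59` (vM by evaluation; U11-G in all three letter forms; U11-P not
invoked). [original] -/
theorem w472_admissible : SieveAdmissibleVP 472 (![6, 6, 6, 6, 3] : Fin 5 → ℕ) ![6, 6, 6, 6, 4] ![8, 8, 8, 8, 4] := by
  refine ⟨?_, ?_, fun hp => absurd hp (by norm_num)⟩
  · refine ⟨by decide, by decide, by decide, by decide, by decide, ?_, ?_⟩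
    · intro l
      refine ⟨by revert l; decide, fun h => absurd h (by revert l; decide), by revert l; decide,
        fun h => absurd h (by revert l; decide), by revert l; decide, fun h => absurd h (by revert l; decide)⟩
    · intro l
      refine ⟨fun h _ => absurd h (by revert l; decide), fun h _ => absurd h (by revert l; decide),
        fun h _ => absurd h (by revert l; decide)⟩
  · refine ⟨?_, ?_, ?_⟩ <;> (unfold U11GFormB; decide)

/-- The 472 witness is E3⁺-admissible (kernel predicate; each `(6,6,8)` member passes with slack `380`, the `(3,4,4)` member is silent).
[original] -/
theorem w472_e3pAdm : E3pAdm 472 (![6, 6, 6, 6, 3] : Fin 5 → ℕ) ![6, 6, 6, 6, 4] ![8, 8, 8, 8, 4] := by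
  intro t _
  revert t
  decide

/-- E3⁺ slack of a `(6,6,8)` member of the 472 witness: off-member sums `S_A = 160`, `S_B = 156`, `S_C = 120`, `288² − e3pLHS = 380`
(REF [255]: `82 944 − 82 564`). [bookkeeping] -/
theorem w472_e3p_slack : 288 ^ 2 - e3pLHS 472 6 6 8 160 156 120 = 380 := by decide

/-- The off-member sums of member `0` of the 472 witness are the ones used in `w472_e3p_slack`. [bookkeeping] -/
theorem w472_offSums :
    (∑ u ∈ univ.erase (0 : Fin 5), (![6, 6, 6, 6, 4] : Fin 5 → ℕ) u * (![8, 8, 8, 8, 4] : Fin 5 → ℕ) u) = 160 ∧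
      (∑ u ∈ univ.erase (0 : Fin 5), (![8, 8, 8, 8, 4] : Fin 5 → ℕ) u * (![6, 6, 6, 6, 3] : Fin 5 → ℕ) u) = 156 ∧
      (∑ u ∈ univ.erase (0 : Fin 5), (![6, 6, 6, 6, 3] : Fin 5 → ℕ) u * (![6, 6, 6, 6, 4] : Fin 5 → ℕ) u) = 120 := by
  refine ⟨by decide, by decide, by decide⟩

/-- **The instrument vQ is blind at order 472 for T_E**: an explicit vP ∧ E3⁺-admissible list with five members beats `5/2` there.
[original] -/
theorem vqCensusTE_fails_at_472 :
    ∃ (N : ℕ) (a b c : Fin N → ℕ), 2 ≤ N ∧ SieveAdmissibleVP 472 a b c ∧ E3pAdm 472 a b c ∧ Beats (5 / 2) 472 a b c :=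
  ⟨5, ![6, 6, 6, 6, 3], ![6, 6, 6, 6, 4], ![8, 8, 8, 8, 4], by norm_num, w472_admissible, w472_e3pAdm, w472_beats⟩

/-- **No vQ census statement for T_E reaches any order `M ≥ 472`** (E3⁺ form — the registered instrument; = planner scratch no. 9's
statement). [original] -/
theorem vqpCensusTE_false_above_472 {M : ℕ} (hM : 472 ≤ M) :
    ¬ (∀ (N M' : ℕ) (a b c : Fin N → ℕ), 2 ≤ N → M' ≤ M → SieveAdmissibleVP M' a b c → E3pAdm M' a b c →
        ¬ Beats (5 / 2) M' a b c) :=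
  fun h => h 5 472 (![6, 6, 6, 6, 3] : Fin 5 → ℕ) ![6, 6, 6, 6, 4] ![8, 8, 8, 8, 4] (by norm_num) hM w472_admissible w472_e3pAdm
    w472_beats

/-- The same in the weaker E3 shape-form reading. [original] -/
theorem vqCensusTE_false_above_472 {M : ℕ} (hM : 472 ≤ M) :
    ¬ (∀ (N M' : ℕ) (a b c : Fin N → ℕ), 2 ≤ N → M' ≤ M → SieveAdmissibleVP M' a b c → TAKnap575.E3Adm M' a b c →
        ¬ Beats (5 / 2) M' a b c) :=
  fun h => h 5 472 (![6, 6, 6, 6, 3] : Fin 5 → ℕ) ![6, 6, 6, 6, 4] ![8, 8, 8, 8, 4] (by norm_num) hM w472_admissible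
    (e3Adm_of_e3pAdm w472_e3pAdm) w472_beats

end AbelianSTPPCensusVP

end Summit.MatrixMultiplication.MatrixMultiplication.Theorems
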